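import Summits.CriticalPhenomena.PercolationContinuityZ3.Theorems.PercNearOneGluingNoHeavyQuantKnScaleDefect
import Literature.Probability.LatticeModels.ThermodynamicLimit
import HarnessLib
import HarnessLib.Audit.Tags

/-!
# QUANT lane R7a, part 2: the Kozma–Nitzan window top `knLHi d m` is at most a double exponential of a power of `m`,
# with CLOSED-FORM natural-number constants

builds on p205010 (kernel theorem, internal audit signed; external expert review pending)

Cell `prim-quant` (LANE 1), seat `prim-quant-p4` (gen 2), lead task R7a ("make the landed rate READABLE").  The explicit one-arm
rate `π_{p_c}(N) ≤ (1 − knEta d)^{iterCount (knLHi d) N}` (`Quant.oneArm_explicit_rate_criticalProbI`, p3) runs along the scale map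
`knLHi d m = 25·knK·knS d m` of `…QuantKnConstants`, a composite of ceilings, maxima and the devices of Kozma–Nitzan's Lemma 10
(seed count `knSeeds ~ critDelta^{-seedBound(M)}`, level radius `knRad ~ critDelta^{-2d·Ncont}`), with `M = knM d m ~ m^{1/α_d}` from
DKT's Proposition 1.  Here every piece is bounded by an ELEMENTARY closed form, all constants natural numbers defined below:

* `knAexp d = 4(4d²+6d+1) = 1/dktAlpha d` (`inv_dktAlpha`; `d = 3`: `220`), `knB d = max(2d, 64) ≥ 1/critDelta d`;
* `knM_le`:      `knM d m ≤ knM1 d · m^{A}`                       (`A = knAexp d`, `m ≥ 1`);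
* `seedBound_knM_le`: `seedBound d (knM d m) ≤ knS1 d · m^{A d}`;
* `knSeeds_le`:  `knSeeds d m ≤ knLE d · B^{knS1 d · m^{A d}}`      (`B = knB d`, `knLE d = ⌈log(1/δ_E)⌉`);
* `two_mul_ncont_le`: `2d · Ncont d (knM d m) (knSeeds d m) ≤ knX d m := 2d · knN2 d · B^{(knS1 d + 1) m^{A d}}`;
* `knRad_le`:    `knRad d m ℓ tol ≤ 3 knM d m + ℓ + 4 + B^{knX d m} · knTE d`  (`tol ≥ δ_E`, `knTE d = ⌈1/δ_E⌉`);
* `knLHi_le_lin`: `knLHi d m ≤ knP d · W`, `W = knM d m + B^{knX d m}·knTE d + 1`, `knP d = 25K(800K + 1 761 000(d+1) + 1219)`;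
* **`knLHi_le_tower`**: `knLHi d m ≤ B ^ (B ^ (knKappa d · m ^ (A·d)))` for every `m ≥ 1`, with
  `knKappa d = knP d (knM1 d + knTE d + 1) + 2d·knN2 d + knS1 d + 1`.

So `knLHi d` is dominated by the height-2 tower `m ↦ B_d^(B_d^(κ_d m^{D_d}))`, `D_d = d·knAexp d` (`d = 3`: `B = 64`, `D = 660`);
part 3 (`…QuantExplicitRateElementary.lean`) turns this into `π_{p_c}(N) ≤ (1 − η_d)^{⌊log*_{b_d}(N)/3⌋}` via `…QuantTowerCount`.
Honest size: `knKappa 3` is astronomically large (of order `2^{7.8·10^5}`, dominated by `knS1 3 ~ (2·dktN1)^3`, QUANT.md §10.10) — an explicit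
function tending to `0` and nothing more.  Nothing probabilistic is proved here (pure arithmetic on the closed forms).
[cite: KozmaNitzan2024, §4 Lemma 10 Steps II–III (the seed and level devices), Theorem 6] [cite: DuminilcopinKozmaTassion2020, Proposition 1]
-/

noncomputable section

namespace Summit.CriticalPhenomena.PercolationContinuityZ3.Theorems.Quant

open Literature.Probability.Percolation Literature.Probability.LatticeModels
open Literature.Probability.Percolation.KozmaNitzan Literature.Probability.Percolation.AKN

variable {d : ℕ}

/-! ## The closed-form constants (natural numbers; functions of `d` only) -/

/-- `A_d = 4(4d² + 6d + 1) = 1/α_d`, the inverse of DKT's exponent `dktAlpha d` (`d = 3`: `220`). [cite: DuminilcopinKozmaTassion2020, Proposition 1] -/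
def knAexp (d : ℕ) : ℕ := 4 * (4 * d ^ 2 + 6 * d + 1)

/-- `B_d = max(2d, 64) ≥ 1/critDelta d`, the base of every exponential of the scheme (`d = 3`: `64`). [folklore] -/
def knB (d : ℕ) : ℕ := max (2 * d) 64

/-- `U_d = ⌈τ_U^{-1/α_d}⌉`, the tolerance term of `uniqScale`. [cite: DuminilcopinKozmaTassion2020, Proposition 1] -/
def knU (d : ℕ) : ℕ := ⌈((knTauU d)⁻¹) ^ (dktAlpha d)⁻¹⌉₊

/-- `M₁ = max(n₁, U_d) + 3`: `knM d m ≤ M₁ · m^{A_d}`. [folklore] -/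
def knM1 (d : ℕ) : ℕ := max (dktN1 d (critDelta d)) (knU d) + 3

/-- `S₁ = (2d+1)(2M₁+3)^d + 1`: `seedBound d (knM d m) ≤ S₁ · m^{A_d d}`. [cite: KozmaNitzan2024, §4 Lemma 10 Step III] -/
def knS1 (d : ℕ) : ℕ := (2 * d + 1) * (2 * knM1 d + 3) ^ d + 1

/-- `ℓ_E = ⌈log(1/δ_E)⌉`, the logarithm in the seed count. [cite: KozmaNitzan2024, §4 Lemma 10 Step III (19)] -/
def knLE (d : ℕ) : ℕ := ⌈Real.log (1 / knDeltaE d)⌉₊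

/-- `N₂ = ℓ_E (8M₁+17)^d`: `Ncont ≤ N₂ · m^{A d} · B^{S₁ m^{A d}}`. [cite: KozmaNitzan2024, §4 Lemma 10 Step II] -/
def knN2 (d : ℕ) : ℕ := knLE d * (8 * knM1 d + 17) ^ d

/-- `T_E = ⌈1/δ_E⌉`, the largest inverse tolerance of the three radii. [folklore] -/
def knTE (d : ℕ) : ℕ := ⌈1 / knDeltaE d⌉₊

/-- The exponent bound `X_d(m) = 2d · N₂ · B^{(S₁+1) m^{A d}} ≥ 2d · Ncont`. [cite: KozmaNitzan2024, §4 Lemma 10 Step II] -/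
def knX (d m : ℕ) : ℕ := 2 * d * (knN2 d * knB d ^ ((knS1 d + 1) * m ^ (knAexp d * d)))

/-- The linear coefficient `P_d = 25K(800K + 1 761 000(d+1) + 1219)`: `knLHi ≤ P_d · (M + B^X T_E + 1)`. [folklore] -/
def knP (d : ℕ) : ℕ := 25 * knK * (800 * knK + 1761000 * (d + 1) + 1219)

/-- **The tower constant** `κ_d = P_d (M₁ + T_E + 1) + 2d N₂ + S₁ + 1`: `knLHi d m ≤ B^(B^(κ_d m^{A d}))`. [folklore] -/
def knKappa (d : ℕ) : ℕ := knP d * (knM1 d + knTE d + 1) + 2 * d * knN2 d + knS1 d + 1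

/-! ## Step 1: `knM d m ≤ M₁ m^A` -/

/-- `1/dktAlpha d = knAexp d`. [cite: DuminilcopinKozmaTassion2020, Proposition 1] -/
theorem inv_dktAlpha (d : ℕ) : (dktAlpha d)⁻¹ = (knAexp d : ℝ) := by
  unfold dktAlpha knAexp
  rw [one_div, inv_inv]
  push_cast
  ring

/-- `⌈m^{1/α}⌉ = m^{A}` (the exponent is a natural number). [folklore] -/
theorem ceil_rpow_inv_dktAlpha (d m : ℕ) : ⌈(m : ℝ) ^ (dktAlpha d)⁻¹⌉₊ = m ^ knAexp d := by
  rw [inv_dktAlpha, Real.rpow_natCast]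
  exact_mod_cast Nat.ceil_natCast (m ^ knAexp d)

/-- `1 ≤ knAexp d`. [folklore] -/
theorem one_le_knAexp (d : ℕ) : 1 ≤ knAexp d := by unfold knAexp; omega

/-- **`knM d m ≤ knM1 d · m ^ knAexp d`** for `m ≥ 1`. [folklore] -/
theorem knM_le {m : ℕ} (hm : 1 ≤ m) : knM d m ≤ knM1 d * m ^ knAexp d := by
  have hq : 1 ≤ m ^ knAexp d := Nat.one_le_pow _ _ hm
  have hmq : m ≤ m ^ knAexp d := Nat.le_self_pow (by have := one_le_knAexp d; omega) m
  have hu : uniqScale d (critDelta d) (knTauU d) m ≤ max (dktN1 d (critDelta d)) (knU d) + m ^ knAexp d := by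
    unfold uniqScale
    rw [ceil_rpow_inv_dktAlpha]
    unfold knU
    omega
  unfold knM knM1
  set c := max (dktN1 d (critDelta d)) (knU d)
  have hc : c ≤ c * m ^ knAexp d := Nat.le_mul_of_pos_right c hq
  nlinarith

/-! ## Step 2: the base `B` and the seed count -/

/-- `64 ≤ knB d`. [folklore] -/
theorem knB_ge (d : ℕ) : 64 ≤ knB d := le_max_right _ _

/-- `1 / critDelta d ≤ knB d` (`d ≥ 1`). [folklore] -/
theorem one_div_critDelta_le (hd : 1 ≤ d) : 1 / critDelta d ≤ (knB d : ℝ) := by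
  have hδ := critDelta_pos hd
  have hd1 : (1 : ℝ) ≤ d := by exact_mod_cast hd
  have hd0 : (0 : ℝ) < 2 * d := by linarith
  have hB : (knB d : ℝ) = max (2 * (d : ℝ)) 64 := by unfold knB; push_cast; rfl
  have hB0 : (0 : ℝ) < knB d := by rw [hB]; exact lt_max_of_lt_right (by norm_num)
  have hlow : 1 / (knB d : ℝ) ≤ critDelta d := by
    unfold critDelta
    rw [hB]
    exact le_min (one_div_le_one_div_of_le hd0 (le_max_left _ _)) (one_div_le_one_div_of_le (by norm_num) (le_max_right _ _))
  rw [div_le_iff₀ hδ]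
  calc (1 : ℝ) = knB d * (1 / knB d) := by field_simp
    _ ≤ knB d * critDelta d := mul_le_mul_of_nonneg_left hlow hB0.le

/-- `(1 / critDelta d)^n ≤ (knB d)^n'` for `n ≤ n'` (`d ≥ 1`). [folklore] -/
theorem one_div_critDelta_pow_le (hd : 1 ≤ d) {n n' : ℕ} (h : n ≤ n') : (1 / critDelta d) ^ n ≤ ((knB d ^ n' : ℕ) : ℝ) := by
  have hB1 : (1 : ℝ) ≤ knB d := by exact_mod_cast le_trans (by norm_num) (knB_ge d)
  push_cast
  exact (pow_le_pow_left₀ (by have := critDelta_pos hd; positivity) (one_div_critDelta_le hd) n).trans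
    (pow_le_pow_right₀ hB1 h)

/-- **`seedBound d (knM d m) ≤ knS1 d · m^{A d}`** for `m ≥ 1`. [cite: KozmaNitzan2024, §4 Lemma 10 Step III] -/
theorem seedBound_knM_le {m : ℕ} (hm : 1 ≤ m) : seedBound d (knM d m) ≤ knS1 d * m ^ (knAexp d * d) := by
  have hM := knM_le (d := d) hm
  set q := m ^ knAexp d with hq
  have hq1 : 1 ≤ q := Nat.one_le_pow _ _ hm
  have h1 : 2 * knM d m + 3 ≤ (2 * knM1 d + 3) * q := by nlinarith
  have h2 : (2 * knM d m + 3) ^ d ≤ (2 * knM1 d + 3) ^ d * q ^ d := by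
    rw [← mul_pow]; exact Nat.pow_le_pow_left h1 d
  have hqd : q ^ d = m ^ (knAexp d * d) := by rw [hq, ← pow_mul]
  have hqd1 : 1 ≤ m ^ (knAexp d * d) := Nat.one_le_pow _ _ hm
  unfold seedBound knS1
  rw [hqd] at h2
  nlinarith

/-- **`knSeeds d m ≤ knLE d · B^{knS1 d · m^{A d}}`** for `m ≥ 1`, `d ≥ 1`. [cite: KozmaNitzan2024, §4 Lemma 10 Step III (19)] -/
theorem knSeeds_le (hd : 1 ≤ d) {m : ℕ} (hm : 1 ≤ m) :
    knSeeds d m ≤ knLE d * knB d ^ (knS1 d * m ^ (knAexp d * d)) := by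
  unfold knSeeds
  refine Nat.ceil_le.2 ?_
  have hlog0 : 0 ≤ Real.log (1 / knDeltaE d) :=
    Real.log_nonneg (by rw [le_div_iff₀ (knDeltaE_pos d)]; linarith [knDeltaE_lt_one d])
  have hlog : Real.log (1 / knDeltaE d) ≤ knLE d := Nat.le_ceil _
  have hpow := one_div_critDelta_pow_le hd (seedBound_knM_le (d := d) hm)
  have hδ := critDelta_pos hd
  rw [div_eq_mul_one_div, ← one_div_pow]
  push_cast at hpow ⊢
  exact mul_le_mul hlog hpow (by positivity) (Nat.cast_nonneg _)

/-! ## Step 3: the contact count and the level radius -/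

/-- `Ncont d M k = k (8M + 17)^d`. [cite: KozmaNitzan2024, §4 Lemma 10 Step II] -/
theorem ncont_eq (d M k : ℕ) : LData.Ncont d M k = k * (8 * M + 17) ^ d := by
  unfold LData.Ncont LData.Rsep
  rw [card_box]
  congr 2
  ring

/-- **`2d · Ncont d (knM d m) (knSeeds d m) ≤ knX d m`** for `m ≥ 1`, `d ≥ 1`. [cite: KozmaNitzan2024, §4 Lemma 10 Step II] -/
theorem two_mul_ncont_le (hd : 1 ≤ d) {m : ℕ} (hm : 1 ≤ m) :
    2 * d * LData.Ncont d (knM d m) (knSeeds d m) ≤ knX d m := by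
  rw [ncont_eq]
  have hM := knM_le (d := d) hm
  have hk := knSeeds_le hd hm
  set q := m ^ knAexp d with hq
  set Q := m ^ (knAexp d * d) with hQ
  have hq1 : 1 ≤ q := Nat.one_le_pow _ _ hm
  have h1 : 8 * knM d m + 17 ≤ (8 * knM1 d + 17) * q := by nlinarith
  have h2 : (8 * knM d m + 17) ^ d ≤ (8 * knM1 d + 17) ^ d * Q := by
    rw [hQ, pow_mul, ← mul_pow]; exact Nat.pow_le_pow_left h1 d
  have hB2 : 2 ≤ knB d := le_trans (by norm_num) (knB_ge d)
  have hQB : Q ≤ knB d ^ Q := (Nat.lt_pow_self (by omega)).le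
  unfold knX knN2
  have hBpow : knB d ^ (knS1 d * Q) * knB d ^ Q = knB d ^ ((knS1 d + 1) * Q) := by rw [← pow_add]; ring_nf
  calc 2 * d * (knSeeds d m * (8 * knM d m + 17) ^ d)
      ≤ 2 * d * ((knLE d * knB d ^ (knS1 d * Q)) * ((8 * knM1 d + 17) ^ d * Q)) := by gcongr
    _ ≤ 2 * d * ((knLE d * knB d ^ (knS1 d * Q)) * ((8 * knM1 d + 17) ^ d * knB d ^ Q)) := by gcongr
    _ = 2 * d * (knLE d * (8 * knM1 d + 17) ^ d * knB d ^ ((knS1 d + 1) * Q)) := by rw [← hBpow]; ring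

/-- **`knRad d m ℓ tol ≤ 3 knM d m + ℓ + 4 + B^{knX d m} · knTE d`** for `tol ≥ δ_E`, `m ≥ 1`, `d ≥ 1`.
[cite: KozmaNitzan2024, §4 Lemma 10 Step II] -/
theorem knRad_le (hd : 1 ≤ d) {m : ℕ} (hm : 1 ≤ m) (ℓ : ℕ) {tol : ℝ} (htol : knDeltaE d ≤ tol) :
    knRad d m ℓ tol ≤ 3 * knM d m + ℓ + 4 + knB d ^ knX d m * knTE d := by
  unfold knRad
  have hE := one_div_critDelta_pow_le hd (two_mul_ncont_le hd hm)
  have hδE := knDeltaE_pos d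
  have htol0 : 0 < tol := lt_of_lt_of_le hδE htol
  have hT : 1 / tol ≤ knTE d := (one_div_le_one_div_of_le hδE htol).trans (Nat.le_ceil _)
  have hceil : ⌈(1 / critDelta d) ^ (2 * d * LData.Ncont d (knM d m) (knSeeds d m)) / tol⌉₊ ≤ knB d ^ knX d m * knTE d := by
    refine Nat.ceil_le.2 ?_
    rw [div_eq_mul_one_div]
    push_cast at hE ⊢
    exact mul_le_mul hE hT (by positivity) (by positivity)
  omega

/-! ## Step 4: every scale is linear in `W = M + B^X T_E + 1` -/

section linear

variable (hd : 1 ≤ d) {m : ℕ} (hm : 1 ≤ m)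
include hd hm

/-- `knR0 d m ≤ 4W` with `W = knM d m + B^X T_E + 1`. [folklore] -/
theorem knR0_le_lin : knR0 d m ≤ 4 * (knM d m + knB d ^ knX d m * knTE d + 1) := by
  have h := knRad_le hd hm (knM d m) (le_refl (knDeltaE d))
  unfold knR0
  omega

/-- `knA d m K' ≤ 200 K' W` for `K' ≥ 1`. [folklore] -/
theorem knA_le_lin {K' : ℕ} (hK' : 1 ≤ K') : knA d m K' ≤ 200 * K' * (knM d m + knB d ^ knX d m * knTE d + 1) := by
  -- with `W = M + B^X T_E + 1`: `R₀ ≤ 4W`, `m ≤ W`, `1 ≤ W`, so `8(3K' + 3K'R₀ + 2m + 8) ≤ 8(15K' + 10)W ≤ 200K'W`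
  obtain ⟨W, hW⟩ : ∃ W, W = knM d m + knB d ^ knX d m * knTE d + 1 := ⟨_, rfl⟩
  have hW1 : 1 ≤ W := by omega
  have hmW : m ≤ W := by have := lt_knM d m; omega
  have hR0 : knR0 d m ≤ 4 * W := by rw [hW]; exact knR0_le_lin hd hm
  have h1 : K' * knR0 d m ≤ K' * (4 * W) := Nat.mul_le_mul_left _ hR0
  have h2 : K' ≤ K' * W := Nat.le_mul_of_pos_right _ hW1
  have h3 : W ≤ K' * W := Nat.le_mul_of_pos_left _ hK'
  rw [← hW]
  unfold knA
  linarith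

/-- `knRT d m ≤ (9 + 400K) W`. [folklore] -/
theorem knRT_le_lin : knRT d m ≤ (9 + 400 * knK) * (knM d m + knB d ^ knX d m * knTE d + 1) := by
  have hA := knA_le_lin hd hm (K' := 2 * knK) (by have := knK_pos; omega)
  have hLT : knLT d m ≤ knM d m + knA d m (2 * knK) := by unfold knLT; omega
  have hR := knRad_le hd hm (knLT d m) (knDeltaE_le_delta d)
  have hET0 : 0 ≤ knB d ^ knX d m * knTE d := Nat.zero_le _
  have hKET0 : 0 ≤ knK * (knB d ^ knX d m * knTE d) := Nat.zero_le _
  have hKM0 : 0 ≤ knK * knM d m := Nat.zero_le _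
  unfold knRT
  linarith

/-- `knRC d m ≤ 17609 W`. [folklore] -/
theorem knRC_le_lin : knRC d m ≤ 17609 * (knM d m + knB d ^ knX d m * knTE d + 1) := by
  have hA := knA_le_lin hd hm (K' := 88) (by norm_num)
  have hLC : knLC d m ≤ knM d m + knA d m 88 := by unfold knLC; omega
  have hR := knRad_le hd hm (knLC d m) (knDeltaE_le_deltaCorr d)
  unfold knRC
  omega

/-- `knS d m ≤ (800K + 1761000(d+1) + 1219) W`. [folklore] -/
theorem knS_le_lin : knS d m ≤ (800 * knK + 1761000 * (d + 1) + 1219) * (knM d m + knB d ^ knX d m * knTE d + 1) := by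
  have hRT := knRT_le_lin hd hm
  have hRC := knRC_le_lin hd hm
  have hA6 := knA_le_lin hd hm (K' := 6) (by norm_num)
  have h1 : (d + 1) * (knRC d m + 1) ≤ (d + 1) * (17609 * (knM d m + knB d ^ knX d m * knTE d + 1) + 1) :=
    Nat.mul_le_mul_left _ (by omega)
  have hET0 : 0 ≤ knB d ^ knX d m * knTE d := Nat.zero_le _
  have hdET0 : 0 ≤ d * (knB d ^ knX d m * knTE d) := Nat.zero_le _
  have hdM0 : 0 ≤ d * knM d m := Nat.zero_le _
  unfold knS
  have hmax : max (max (2 * knRT d m) (100 * (d + 1) * (knRC d m + 1))) (max (knA d m 6) 1) ≤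
      2 * knRT d m + 100 * (d + 1) * (knRC d m + 1) + knA d m 6 + 1 := by omega
  refine hmax.trans ?_
  linarith

/-- **`knLHi d m ≤ knP d · W`**, `W = knM d m + B^{knX d m} T_E + 1`. [folklore] -/
theorem knLHi_le_lin : knLHi d m ≤ knP d * (knM d m + knB d ^ knX d m * knTE d + 1) := by
  have hS := Nat.mul_le_mul_left (25 * knK) (knS_le_lin hd hm)
  unfold knLHi knR knP
  calc 25 * (knK * knS d m) = 25 * knK * knS d m := by ring
    _ ≤ 25 * knK * ((800 * knK + 1761000 * (d + 1) + 1219) * (knM d m + knB d ^ knX d m * knTE d + 1)) := hS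
    _ = 25 * knK * (800 * knK + 1761000 * (d + 1) + 1219) * (knM d m + knB d ^ knX d m * knTE d + 1) := by ring

end linear

/-! ## Step 5: the tower bound -/

/-- `n ≤ B^n`. [folklore] -/
theorem le_knB_pow (d n : ℕ) : n ≤ knB d ^ n :=
  (Nat.lt_pow_self (by have := knB_ge d; omega)).le

/-- `1 ≤ knLE d` (`δ_E < 1`). [folklore] -/
theorem one_le_knLE (d : ℕ) : 1 ≤ knLE d := by
  unfold knLE
  refine Nat.one_le_iff_ne_zero.2 (Nat.pos_iff_ne_zero.1 (Nat.ceil_pos.2 (Real.log_pos ?_)))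
  rw [lt_div_iff₀ (knDeltaE_pos d)]; linarith [knDeltaE_lt_one d]

/-- `1 ≤ knTE d`. [folklore] -/
theorem one_le_knTE (d : ℕ) : 1 ≤ knTE d := by
  unfold knTE
  refine Nat.one_le_iff_ne_zero.2 (Nat.pos_iff_ne_zero.1 (Nat.ceil_pos.2 ?_))
  have := knDeltaE_pos d; positivity

/-- **THE TOWER BOUND**: `knLHi d m ≤ B ^ (B ^ (knKappa d · m ^ (knAexp d · d)))` for every `m ≥ 1` (`d ≥ 1`), `B = knB d = max(2d, 64)`.
So the Kozma–Nitzan window top is dominated by a height-2 exponential tower over the polynomial `κ_d m^{D_d}`, `D_d = d · knAexp d`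
(`d = 3`: `64^(64^(κ₃ m^660))`).  An explicit function and nothing more.  builds on p205010 (kernel theorem, internal audit signed;
external expert review pending). [cite: KozmaNitzan2024, §4 Lemma 10 Steps II–III and Theorem 6] -/
theorem knLHi_le_tower (hd : 1 ≤ d) {m : ℕ} (hm : 1 ≤ m) :
    knLHi d m ≤ knB d ^ (knB d ^ (knKappa d * m ^ (knAexp d * d))) := by
  set B := knB d with hBdef
  set Q := m ^ (knAexp d * d) with hQ
  set y := (knS1 d + 1) * Q with hy
  set X := knX d m with hXdef
  set c₁ := knP d * (knM1 d + knTE d + 1) with hc₁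
  have hB1 : 1 ≤ B := le_trans (by norm_num) (knB_ge d)
  have hQ1 : 1 ≤ Q := Nat.one_le_pow _ _ hm
  have hqQ : m ^ knAexp d ≤ Q := by
    rw [hQ, pow_mul]; exact Nat.le_self_pow (by omega) _
  have hX : X = 2 * d * knN2 d * B ^ y := by rw [hXdef]; unfold knX; rw [hBdef, hy, hQ]; ring
  have hN : 1 ≤ 2 * d * knN2 d := by
    have h1 := one_le_knLE d
    have h2 : 1 ≤ (8 * knM1 d + 17) ^ d := Nat.one_le_pow _ _ (by omega)
    have : 1 ≤ knN2 d := by unfold knN2; nlinarith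
    nlinarith
  have hyQ : Q ≤ y := Nat.le_mul_of_pos_left _ (Nat.succ_pos _)
  have hXy : B ^ y ≤ X := by rw [hX]; exact Nat.le_mul_of_pos_left _ hN
  have hQX : Q ≤ B ^ X := (hyQ.trans ((le_knB_pow d y).trans hXy)).trans (le_knB_pow d X)
  have hBX1 : 1 ≤ B ^ X := Nat.one_le_pow _ _ hB1
  have hBy1 : 1 ≤ B ^ y := Nat.one_le_pow _ _ hB1
  have hT1 := one_le_knTE d
  -- `W ≤ (M₁ + T_E + 1) B^X`
  have hM : knM d m ≤ knM1 d * B ^ X :=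
    (knM_le hm).trans ((Nat.mul_le_mul_left _ hqQ).trans (Nat.mul_le_mul_left _ hQX))
  have hW : knM d m + B ^ X * knTE d + 1 ≤ (knM1 d + knTE d + 1) * B ^ X := by nlinarith
  have h1 : knLHi d m ≤ c₁ * B ^ X := by
    have := knLHi_le_lin hd hm
    have h' : knP d * (knM d m + B ^ X * knTE d + 1) ≤ knP d * ((knM1 d + knTE d + 1) * B ^ X) :=
      Nat.mul_le_mul_left _ hW
    rw [hc₁, mul_assoc]; exact this.trans h'
  have h2 : c₁ * B ^ X ≤ B ^ (c₁ + X) := by rw [pow_add]; exact Nat.mul_le_mul_right _ (le_knB_pow d c₁)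
  have h3 : c₁ + X ≤ (c₁ + 2 * d * knN2 d) * B ^ y := by
    rw [hX]; nlinarith
  have h4 : (c₁ + 2 * d * knN2 d) * B ^ y ≤ B ^ (c₁ + 2 * d * knN2 d + y) := by
    rw [pow_add]; exact Nat.mul_le_mul_right _ (le_knB_pow d _)
  have h5 : c₁ + 2 * d * knN2 d + y ≤ knKappa d * Q := by
    unfold knKappa; rw [hy]; nlinarith
  calc knLHi d m ≤ c₁ * B ^ X := h1
    _ ≤ B ^ (c₁ + X) := h2
    _ ≤ B ^ ((c₁ + 2 * d * knN2 d) * B ^ y) := Nat.pow_le_pow_right hB1 h3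
    _ ≤ B ^ (B ^ (c₁ + 2 * d * knN2 d + y)) := Nat.pow_le_pow_right hB1 h4
    _ ≤ B ^ (B ^ (knKappa d * Q)) := Nat.pow_le_pow_right hB1 (Nat.pow_le_pow_right hB1 h5)

/-! ## Step 6: one more than a scale — the triple-exponential step with a single base `b_d` -/

/-- **The tower base** `b_d = max(B_d, κ_d · 4^{D_d})`, `D_d = knAexp d · d`: `knLHi d (n+1) ≤ b_d^(b_d^(b_d^n))` for `n ≥ 1`. [folklore] -/
def knBase (d : ℕ) : ℕ := max (knB d) (knKappa d * 4 ^ (knAexp d * d))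

/-- `64 ≤ knBase d` (in particular `2 ≤ knBase d`). [folklore] -/
theorem knBase_ge (d : ℕ) : 64 ≤ knBase d := (knB_ge d).trans (le_max_left _ _)

/-- `κ_d (n+1)^{D} ≤ b_d^n` for `n ≥ 1`: `(n+1)^D ≤ 2^D n^D ≤ 2^D (2^D)^n` and `κ 2^D ≤ (κ 2^D)^n`. [folklore] -/
theorem knKappa_mul_pow_le {n : ℕ} (hn : 1 ≤ n) : knKappa d * (n + 1) ^ (knAexp d * d) ≤ knBase d ^ n := by
  obtain ⟨D, hD⟩ : ∃ D, D = knAexp d * d := ⟨_, rfl⟩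
  obtain ⟨κ, hκ⟩ : ∃ κ, κ = knKappa d := ⟨_, rfl⟩
  rw [← hD]
  unfold knBase; rw [← hD, ← hκ]
  have hκ1 : 1 ≤ κ := by rw [hκ]; unfold knKappa; omega
  have h1 : (n + 1) ^ D ≤ 2 ^ D * n ^ D := by
    rw [← mul_pow]; exact Nat.pow_le_pow_left (by omega) D
  have h2 : n ^ D ≤ (2 ^ D) ^ n := by
    calc n ^ D ≤ (2 ^ n) ^ D := Nat.pow_le_pow_left (Nat.lt_two_pow_self).le D
      _ = (2 ^ D) ^ n := by rw [← pow_mul, ← pow_mul, mul_comm]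
  have h3 : κ * 2 ^ D ≤ (κ * 2 ^ D) ^ n := by
    conv_lhs => rw [← pow_one (κ * 2 ^ D)]
    exact Nat.pow_le_pow_right (by positivity) hn
  have h4 : (4 : ℕ) ^ D = 2 ^ D * 2 ^ D := by rw [show (4 : ℕ) = 2 * 2 from rfl, mul_pow]
  calc κ * (n + 1) ^ D ≤ κ * (2 ^ D * n ^ D) := Nat.mul_le_mul_left _ h1
    _ = κ * 2 ^ D * n ^ D := by ring
    _ ≤ (κ * 2 ^ D) ^ n * (2 ^ D) ^ n := Nat.mul_le_mul h3 h2
    _ = (κ * 4 ^ D) ^ n := by rw [← mul_pow, h4]; ring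
    _ ≤ (max (knB d) (κ * 4 ^ D)) ^ n := Nat.pow_le_pow_left (le_max_right _ _) n

/-- **`knLHi d (n+1) ≤ b_d ^ (b_d ^ (b_d ^ n))`** for every `n ≥ 1` (`d ≥ 1`): one step of the scale sequence costs at most three
exponentials to the single base `b_d = knBase d`.  With `…QuantTowerCount` this gives `scaleSeq (knLHi d) j ≤ b_d ↑↑ (3j)` and
`⌊log*_{b_d}(N)/3⌋ ≤ iterCount (knLHi d) N`.  An explicit function and nothing more.
builds on p205010 (kernel theorem, internal audit signed; external expert review pending). [cite: KozmaNitzan2024, §4 Theorem 6] -/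
theorem knLHi_succ_le_exp3 (hd : 1 ≤ d) {n : ℕ} (hn : 1 ≤ n) :
    knLHi d (n + 1) ≤ knBase d ^ (knBase d ^ (knBase d ^ n)) := by
  have hB1 : 1 ≤ knB d := le_trans (by norm_num) (knB_ge d)
  have hb1 : 1 ≤ knBase d := le_trans (by norm_num) (knBase_ge d)
  have hBb : knB d ≤ knBase d := le_max_left _ _
  calc knLHi d (n + 1) ≤ knB d ^ (knB d ^ (knKappa d * (n + 1) ^ (knAexp d * d))) := knLHi_le_tower hd (by omega)
    _ ≤ knBase d ^ (knB d ^ (knKappa d * (n + 1) ^ (knAexp d * d))) := Nat.pow_le_pow_left hBb _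
    _ ≤ knBase d ^ (knBase d ^ (knKappa d * (n + 1) ^ (knAexp d * d))) :=
        Nat.pow_le_pow_right hb1 (Nat.pow_le_pow_left hBb _)
    _ ≤ knBase d ^ (knBase d ^ (knBase d ^ n)) :=
        Nat.pow_le_pow_right hb1 (Nat.pow_le_pow_right hb1 (knKappa_mul_pow_le hn))

end Summit.CriticalPhenomena.PercolationContinuityZ3.Theorems.Quant

end
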